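import Mathlib
import HarnessLib
import HarnessLib.Audit
import Summits.Langlands.Statement
import Summits.Langlands.Langlands.Theses.PrimeSwitchSplit
import Summits.Langlands.Langlands.Theses.MotivicDictionarySplit
import Summits.Langlands.Langlands.Theorems.HigherMotivicReciprocityAbelianTypeSplit
import Summits.Langlands.Langlands.Theorems.HigherMotivicReciprocityAbelianTypeDissolution
import Literature.AlgebraicGeometry.Motives.Varieties
import Literature.AlgebraicGeometry.Motives.GaloisRealization
import Literature.AlgebraicGeometry.Motives.EllAdicEtaleRational
import Literature.NumberTheory.GaloisRepresentations.LabelledHodgeTateWeights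
import Literature.NumberTheory.PAdicHodge.FontaineDpst
import Literature.NumberTheory.Automorphic.GLnAdelicStructureProofs

/-!
# WeightOneVisibilitySplit — lens-2 g34 node (structural dichotomy, special side, two levels down): the weight-one cell AVR by LABELLED HODGE–TATE MULTIPLICITY

seat `decomp-langlands-lens-2-g34` · 2026-08-31 · kit `run/shared/lean/pub/decomp-langlands/decomp-langlands-lens-2/g34/` (texts34.py renders every statement
below from the tree text of `Theses/MotivicDictionarySplit.lean`: each cell = AVR + ONE insertion at offset 2093) · memo `WeightOneVisibilitySplit.md`.
LANGLANDS ROUTE FREEZE honoured: this file is TYPED-NOT-FILED by the seat (0 ledger writes); landing twin target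
`Theorems/AbelianMotivicReciprocityWeightOneVisibilitySplit.lean --supports stmt-Langlands-27425 --as helper` (census), hygiene: no decl named `closes`,
no decl named like an existing route item, no cite-tags in the docstrings of section-variable defs (refs in prose).

## Target (tree decls BY NAME)
* AVR = `Summit.Langlands.Langlands.Theses.MotivicDictionarySplit.AbelianMotivicReciprocity` (stmt-Langlands-27425, crux r2, ATTACKABLE, route OPEN; registered
  birth cut «n = 2 ∧ K = ℚ ∣ n = 2 ∧ K ≠ ℚ ∣ n ≠ 2»): reciprocity for the irreducible pinned-geometric ρ realised, up to Tate twist, in some H¹_ét(X_K̄, ℚ_ℓ)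
  — the twisted simple constituents of Tate modules of abelian varieties over K (the WEIGHT-ONE population);
* host chain: AVR → `MotivicDictionarySplit.closes` (+HMR 27426, NMR 27427) → B_w = `PrimeSwitchSplit.WeakGeometricAutomorphy` (17414) → `PrimeSwitchSplit.closes` → `Langlands`.

## The move
Read the lens-2 g0 dial — the LABELLED HODGE–TATE MULTIPLICITY m(ρ) (g0 `WeightMultiplicitySplit`, (B)-clause, at Reciprocity level) — on the weight-one
population, where two things happen at once: (1) by Knapp–Zuckerman's non-degeneracy criterion on real forms with TWO compact unitary blocks (U(p,q), GSp₄(ℝ))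
«every labelled multiplicity ≤ 2» is EXACTLY «a non-zero limit of discrete series with this infinitesimal character exists» (one copy of each repeated entry per
block), so the chambers m = 1 ∣ m = 2 ∣ m ≥ 3 ARE the three archimedean regimes discrete series (ℓ₀ = 0) ∣ non-degenerate limit (ℓ₀ = 1, coherent cohomology in
singular weight) ∣ degenerate limit (no realisation in any cohomology of a Shimura variety — Mirković / Goldring §4.4.1); (2) the Hodge–Tate shape of H¹ (Tate /
Fontaine / Faltings: n weights, ≤ 2 distinct values — the PRINT DOOR `WeightOneHodgeTateShape`, node-only) makes each chamber a FINITE TYPE LIST (kernel):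
m = 1 ⟺ rank ≤ 2 (characters, elliptic curves, GL₂-type), m = 2 ⟹ rank ≤ 4 (definite CM ⊗ Artin₂, Picard (2,1) threefolds, abelian surfaces / U(2,2) / A₁ ⊗ A₁ of
shape (2,2)), rank ≥ 5 ⟹ m ≥ 3 (generic abelian varieties of dimension g ≥ 3: the director's «bulk», filed as ONE theorem-sealed residual).

| piece | decl | := AVR VERBATIM + | kind / rank (would-be child route V-W) | tag |
|---|---|---|---|---|
| REG₁ | `RegularWeightOneReciprocity` | `→ (mult ≤ 1) → concl` | crux 2 | WEAKER · S-implied · ATTACKABLE (ℓ₀ = 0: TW–Kisin / ACC⁺; n = 1 = item 24805 by name; dark only over mixed-signature K) |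
| WALL₁ | `WallWeightOneReciprocity` | `→ ¬(mult ≤ 1) → (mult ≤ 2) → concl` | crux 3 | WEAKER · S-implied · INSTRUMENTABLE (ℓ₀ = 1: Calegari–Geraghty + higher Hida; BCGP at (2,2)); Artin-dark CM ⊗ Artin sub-core placed |
| DEG₁ | `DegenerateWeightOneReciprocity` | `→ ¬(mult ≤ 2) → concl` | residual 4 | WEAKER · S-implied · BARRIER (Knapp–Zuckerman / Mirković / NonRegularWeight / ShimuraVarietyRealization): declared residual |
| Assembly | REG₁ → WALL₁ → DEG₁ → AVR | — | assembly 1 | proved: `closes_target` (0 sorry) |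
| door | `WeightOneHodgeTateShape` | AVR-hypotheses → ∃ label, card = n ∧ ≤ 2 distinct values | node-only, never an item | PRINT (Tate 1967 Cor. 2; Fontaine 1982; Faltings 1988) |

ORBIT-CLOSED DIAL: m(ρ) is read label-by-label from the Hodge–Tate multiset — invariant under twists by geometric characters, duals, change of (ℓ, ι) in the
compatible system (Hodge numbers of the cutting idempotent), restriction to Γ_L for finite L/K (labels of L over τ carry the same multiset) and every finite-image /
solvable-descent move: no cell leaks under base change or descent (= g0 row 3's certificate, two levels down).

## Kernel (this file: rc 0 · 0 sorry · axioms [propext, Classical.choice, Quot.sound])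
`closes_target : REG₁ → WALL₁ → DEG₁ → AVR` (TARGET BY NAME) · `abelianMotivicReciprocity_iff_cells : AVR ↔ REG₁ ∧ WALL₁ ∧ DEG₁` (EXACT) · `closes_parent` (+HMR, NMR ⟹ B_w) ·
`closes_root` (+N0's five ⟹ `Langlands`) · `closes_hmr_dissolved` / `closes_parent_dissolved` (JUNCTION with g33's landed `Theorems/HigherMotivicReciprocityAbelianTypeDissolution`:
HMR ⟸ REG₁ ∧ WALL₁ ∧ DEG₁ ∧ TW1 ∧ ATT ∧ XRR ∧ XIR) · certs `B_w ⟹ cell`, `AVR ⟹ cell` · finiteness mod the door: `regularWeightOne_iff_rankLeTwo`, `wallWeightOne_iff_rankLeFour`,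
`not_visible_of_five_le` (via `card_le_mul_toFinset_card_of_count_le`).
bc7 (HarnessLib crux probe, batteries P1–P5): REG₁ / WALL₁ / DEG₁ CLEAN vs `Langlands` and vs AVR (90 s budget reruns where a battery timed out).
Vehicles (pen-holders', see RUNME.md): LINE `weight-one-visibility` on 27425 (3 stubs = the cells; rc 0, sorries = stubs; differs from the registered birth at the
third stub: «n ≠ 2» is cut into the visible wall and the sealed bulk); child route V-W `vr.route.json` + `vr.glue.lean` (`--refines
route-Langlands-MotivicDictionarySplit:AbelianMotivicReciprocity`; native check OK, cone 3/3; tribunal tk=PROVISIONAL, t1 clean ×3, DEG₁ residual); births ×3 (door ∣ item 24805 ∣ rank 2;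
door ∣ rank ≤ 2 ∣ 3 ∣ 4; rank ≤ 4 ∣ ≥ 5 — sorries = stubs, compositions kernel-checked).
-/


namespace Summit.Langlands.Langlands.Theorems.WeightOneVisibilitySplit

/-! ### Vocabulary — the dial (lens-2 g0 `WeightMultiplicitySplit` (B)-clause phrasing, read on one ρ) -/
section Vocabulary
variable (K : Type) [Field K] [NumberField K] (ℓ : ℕ) [Fact ℓ.Prime] (n : ℕ)
  (ρ : Literature.NumberTheory.GaloisRepresentations.FramedGaloisRep K (PadicAlgCl ℓ) n)

/-- `HasLabelledHTMultiplicityAtMost K ℓ n ρ c`: at every place `v ∣ ℓ` and every continuous label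
`τ : K_v →+* ℚ̄_ℓ` (pinned Fontaine data `fontainePstAdicCompletion v ℓ hv`), every labelled Hodge–Tate weight of `ρ`
occurs with multiplicity `≤ c`.  `c = 1`: REGULAR; `c = 2`: the LIMIT-OF-DISCRETE-SERIES-VISIBLE chamber
(Vogan–Zuckerman / Knapp–Zuckerman non-degeneracy: a limit of discrete series with two repeated infinitesimal
character entries inside one compact block vanishes); `¬ (c = 2)`: DEGENERATE (Goldring §4.4.1 / Mirković). -/
def HasLabelledHTMultiplicityAtMost (c : ℕ) : Prop :=
  ∀ (v : IsDedekindDomain.HeightOneSpectrum (NumberField.RingOfIntegers K)) (hv : ((ℓ : ℕ) : NumberField.RingOfIntegers K) ∈ v.asIdeal) (τ : v.adicCompletion K →+* PadicAlgCl ℓ), Continuous τ → ∀ w : ℤ, (ρ.labelledHodgeTateWeightsAt v (Literature.NumberTheory.PAdicHodge.fontainePstAdicCompletion v ℓ hv).algebra (Literature.NumberTheory.PAdicHodge.fontainePstAdicCompletion v ℓ hv).𝔅 τ).count w ≤ c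

/-- Monotonicity of the dial: multiplicity at most `c` implies multiplicity at most `c'` for `c ≤ c'`
(so the chambers «≤ 1» ⊂ «≤ 2» are nested and the three cells partition AVR's population). -/
theorem hasLabelledHTMultiplicityAtMost_mono
    {c c' : ℕ} (hcc : c ≤ c') (h : HasLabelledHTMultiplicityAtMost K ℓ n ρ c) :
    HasLabelledHTMultiplicityAtMost K ℓ n ρ c' :=
  fun v hv τ hτ w => (h v hv τ hτ w).trans hcc

/-- the REGULAR guard of the cells, by name -/
theorem hasLabelledHTMultiplicityAtMost_one_iff :
    HasLabelledHTMultiplicityAtMost K ℓ n ρ 1 ↔ (∀ (v : IsDedekindDomain.HeightOneSpectrum (NumberField.RingOfIntegers K)) (hv : ((ℓ : ℕ) : NumberField.RingOfIntegers K) ∈ v.asIdeal) (τ : v.adicCompletion K →+* PadicAlgCl ℓ), Continuous τ → ∀ w : ℤ, (ρ.labelledHodgeTateWeightsAt v (Literature.NumberTheory.PAdicHodge.fontainePstAdicCompletion v ℓ hv).algebra (Literature.NumberTheory.PAdicHodge.fontainePstAdicCompletion v ℓ hv).𝔅 τ).count w ≤ 1) := Iff.rfl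

/-- the VISIBLE guard of the cells, by name -/
theorem hasLabelledHTMultiplicityAtMost_two_iff :
    HasLabelledHTMultiplicityAtMost K ℓ n ρ 2 ↔ (∀ (v : IsDedekindDomain.HeightOneSpectrum (NumberField.RingOfIntegers K)) (hv : ((ℓ : ℕ) : NumberField.RingOfIntegers K) ∈ v.asIdeal) (τ : v.adicCompletion K →+* PadicAlgCl ℓ), Continuous τ → ∀ w : ℤ, (ρ.labelledHodgeTateWeightsAt v (Literature.NumberTheory.PAdicHodge.fontainePstAdicCompletion v ℓ hv).algebra (Literature.NumberTheory.PAdicHodge.fontainePstAdicCompletion v ℓ hv).𝔅 τ).count w ≤ 2) := Iff.rfl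

end Vocabulary

/-! ### The three cells of AVR = `MotivicDictionarySplit.AbelianMotivicReciprocity` (stmt-Langlands-27425)
Each cell is the TREE TEXT of AVR with ONE hypothesis inserted after the degree-1 realisation hypothesis. -/

/-- REG₁ `RegularWeightOneReciprocity` — crux (rank 2) · [S-implied · WEAKER · ATTACKABLE]:
AVR VERBATIM + the guard «every labelled HT weight has multiplicity ≤ 1».  Under the weight-one Hodge–Tate shape
door (`WeightOneHodgeTateShape`, Fontaine 1982 / Faltings 1988) this is EXACTLY rank ≤ 2 weight one
(`regularWeightOne_iff_rankLeTwo`): n = 1 (CFT, item `PrimitiveRankLadder.RankOneAutomorphy` 24805 by name in the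
birth) and the balanced rank-two weight-one ρ (elliptic curves / GL₂-type abelian varieties / fake ones) over every K —
ℓ₀ = 0 Taylor–Wiles–Kisin territory over totally real K, ACC⁺/Caraiani–Newton over CM K, dark over mixed-signature K. -/
def RegularWeightOneReciprocity : Prop :=
  ∀ (K : Type) [Field K] [NumberField K] (n : ℕ) (hcpt : Literature.NumberTheory.Automorphic.isCompact_glFiniteIntegralLevel n K), 0 < n → ∀ (ℓ : ℕ) [Fact ℓ.Prime] (ι : PadicAlgCl ℓ ≃+* ℂ) (ρ : Literature.NumberTheory.GaloisRepresentations.FramedGaloisRep K (PadicAlgCl ℓ) n), ρ.toGaloisRep.IsIrreducible → ((∀ᶠ v : IsDedekindDomain.HeightOneSpectrum (NumberField.RingOfIntegers K) in Filter.cofinite, ρ.IsUnramifiedAt v) ∧ ∀ (v : IsDedekindDomain.HeightOneSpectrum (NumberField.RingOfIntegers K)) (hv : ((ℓ : ℕ) : NumberField.RingOfIntegers K) ∈ v.asIdeal), (Literature.NumberTheory.PAdicHodge.fontainePstAdicCompletion v ℓ hv).IsDeRhamFramed (ρ.toLocal v)) → (∃ (d : ℕ) (X : Literature.AlgebraicGeometry.Motives.SchemeOver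 K), Literature.AlgebraicGeometry.Motives.IsSmoothProjective d X ∧ ∃ (j : ℤ) (W : Submodule (PadicAlgCl ℓ) (TensorProduct ℚ_[ℓ] (PadicAlgCl ℓ) (Literature.AlgebraicGeometry.Motives.ellAdicEtaleCohomologyRat ℓ 1 (Literature.AlgebraicGeometry.Motives.geometricFibre K X)))) (hW : ∀ (g : Field.absoluteGaloisGroup K) (w : TensorProduct ℚ_[ℓ] (PadicAlgCl ℓ) (Literature.AlgebraicGeometry.Motives.ellAdicEtaleCohomologyRat ℓ 1 (Literature.AlgebraicGeometry.Motives.geometricFibre K X))), w ∈ W → (algebraMap ℚ_[ℓ] (PadicAlgCl ℓ) ((Literature.AlgebraicGeometry.Motives.padicCyclotomicCharacter K ℓ g : ℚ_[ℓ]ˣ) : ℚ_[ℓ])) ^ j • (Literature.AlgebraicGeometry.Motives.geometricEllAdicEtaleCohomologyRepRat ℓ X 1 g).baseChange (PadicAlgCl ℓ) w ∈ W) (f : W →ₗ[PadicAlgCl ℓ] (Fin n → PadicAlgCl ℓ)), Function.Surjective f ∧ ∀ (g : Field.absoluteGaloisGroup K) (w : W), f ⟨(algebraMap ℚ_[ℓ]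 (PadicAlgCl ℓ) ((Literature.AlgebraicGeometry.Motives.padicCyclotomicCharacter K ℓ g : ℚ_[ℓ]ˣ) : ℚ_[ℓ])) ^ j • (Literature.AlgebraicGeometry.Motives.geometricEllAdicEtaleCohomologyRepRat ℓ X 1 g).baseChange (PadicAlgCl ℓ) (w : TensorProduct ℚ_[ℓ] (PadicAlgCl ℓ) (Literature.AlgebraicGeometry.Motives.ellAdicEtaleCohomologyRat ℓ 1 (Literature.AlgebraicGeometry.Motives.geometricFibre K X))), hW g w w.2⟩ = ((ρ g : GL (Fin n) (PadicAlgCl ℓ)) : Matrix (Fin n) (Fin n) (PadicAlgCl ℓ)).mulVec (f w)) → (∀ (v : IsDedekindDomain.HeightOneSpectrum (NumberField.RingOfIntegers K)) (hv : ((ℓ : ℕ) : NumberField.RingOfIntegers K) ∈ v.asIdeal) (τ : v.adicCompletion K →+* PadicAlgCl ℓ), Continuous τ → ∀ w : ℤ, (ρ.labelledHodgeTateWeightsAt v (Literature.NumberTheory.PAdicHodge.fontainePstAdicCompletion v ℓ hv).algebra (Literature.NumberTheory.PAdicHodge.fontainePstAdicCompletion v ℓ hv).𝔅 τ).count w ≤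 1) → ∃ π : Literature.NumberTheory.Automorphic.CuspidalAutomorphicRepData n K hcpt, π.1.IsLAlgebraic ∧ ∀ᶠ v : IsDedekindDomain.HeightOneSpectrum (NumberField.RingOfIntegers K) in Filter.cofinite, Summit.Langlands.SatakeFrobCompatibleAt ι π.1 ρ v

/-- WALL₁ `WallWeightOneReciprocity` — crux (rank 3) · [S-implied · WEAKER · ATTACKABLE/INSTRUMENTABLE (ℓ₀ = 1 class)]:
AVR VERBATIM + «¬ (multiplicity ≤ 1) → (multiplicity ≤ 2)».  Under the door this is rank ≤ 4
(`wallWeightOne_iff_rankLeFour`) and, by weight-one Hodge symmetry, the FOUR exotic visible weight-one types: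
rank 2 definite (2,0)|(0,2) (CM ⊗ 2-dim Artin over CM-containing K; weight-one U(1,1)), rank 3 of shape (2,1) (Picard
U(2,1)-type abelian threefolds; CM-induction from cubic fields — JPSS), rank 4 of shape (2,2) (abelian surfaces /
GSp₄-type over totally real K — BCGP; U(2,2)-type abelian fourfolds over CM K; A₁ × A₁ tensor types — Ramakrishnan).
Every member has a non-degenerate (holomorphic) limit of discrete series at ∞ on a unitary/symplectic similitude inner
form: coherent cohomology of a Shimura variety in singular weight sees it (Calegari–Geraghty ℓ₀ = 1, higher Hida /
Coleman theory). -/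
def WallWeightOneReciprocity : Prop :=
  ∀ (K : Type) [Field K] [NumberField K] (n : ℕ) (hcpt : Literature.NumberTheory.Automorphic.isCompact_glFiniteIntegralLevel n K), 0 < n → ∀ (ℓ : ℕ) [Fact ℓ.Prime] (ι : PadicAlgCl ℓ ≃+* ℂ) (ρ : Literature.NumberTheory.GaloisRepresentations.FramedGaloisRep K (PadicAlgCl ℓ) n), ρ.toGaloisRep.IsIrreducible → ((∀ᶠ v : IsDedekindDomain.HeightOneSpectrum (NumberField.RingOfIntegers K) in Filter.cofinite, ρ.IsUnramifiedAt v) ∧ ∀ (v : IsDedekindDomain.HeightOneSpectrum (NumberField.RingOfIntegers K)) (hv : ((ℓ : ℕ) : NumberField.RingOfIntegers K) ∈ v.asIdeal), (Literature.NumberTheory.PAdicHodge.fontainePstAdicCompletion v ℓ hv).IsDeRhamFramed (ρ.toLocal v)) → (∃ (d : ℕ) (X : Literature.AlgebraicGeometry.Motives.SchemeOver K), Literature.AlgebraicGeometry.Motives.IsSmoothProjective d X ∧ ∃ (j : ℤ) (W : Submodule (PadicAlgCl ℓ) (TensorProduct ℚ_[ℓ] (PadicAlgCl ℓ) (Literature.AlgebraicGeometry.Motives.ellAdicEtaleCohomologyRat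 ℓ 1 (Literature.AlgebraicGeometry.Motives.geometricFibre K X)))) (hW : ∀ (g : Field.absoluteGaloisGroup K) (w : TensorProduct ℚ_[ℓ] (PadicAlgCl ℓ) (Literature.AlgebraicGeometry.Motives.ellAdicEtaleCohomologyRat ℓ 1 (Literature.AlgebraicGeometry.Motives.geometricFibre K X))), w ∈ W → (algebraMap ℚ_[ℓ] (PadicAlgCl ℓ) ((Literature.AlgebraicGeometry.Motives.padicCyclotomicCharacter K ℓ g : ℚ_[ℓ]ˣ) : ℚ_[ℓ])) ^ j • (Literature.AlgebraicGeometry.Motives.geometricEllAdicEtaleCohomologyRepRat ℓ X 1 g).baseChange (PadicAlgCl ℓ) w ∈ W) (f : W →ₗ[PadicAlgCl ℓ] (Fin n → PadicAlgCl ℓ)), Function.Surjective f ∧ ∀ (g : Field.absoluteGaloisGroup K) (w : W), f ⟨(algebraMap ℚ_[ℓ] (PadicAlgCl ℓ) ((Literature.AlgebraicGeometry.Motives.padicCyclotomicCharacter K ℓ g : ℚ_[ℓ]ˣ) : ℚ_[ℓ])) ^ j • (Literature.AlgebraicGeometry.Motives.geometricEllAdicEtaleCohomologyRepRat ℓ X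 1 g).baseChange (PadicAlgCl ℓ) (w : TensorProduct ℚ_[ℓ] (PadicAlgCl ℓ) (Literature.AlgebraicGeometry.Motives.ellAdicEtaleCohomologyRat ℓ 1 (Literature.AlgebraicGeometry.Motives.geometricFibre K X))), hW g w w.2⟩ = ((ρ g : GL (Fin n) (PadicAlgCl ℓ)) : Matrix (Fin n) (Fin n) (PadicAlgCl ℓ)).mulVec (f w)) → ¬ (∀ (v : IsDedekindDomain.HeightOneSpectrum (NumberField.RingOfIntegers K)) (hv : ((ℓ : ℕ) : NumberField.RingOfIntegers K) ∈ v.asIdeal) (τ : v.adicCompletion K →+* PadicAlgCl ℓ), Continuous τ → ∀ w : ℤ, (ρ.labelledHodgeTateWeightsAt v (Literature.NumberTheory.PAdicHodge.fontainePstAdicCompletion v ℓ hv).algebra (Literature.NumberTheory.PAdicHodge.fontainePstAdicCompletion v ℓ hv).𝔅 τ).count w ≤ 1) → (∀ (v : IsDedekindDomain.HeightOneSpectrum (NumberField.RingOfIntegers K)) (hv : ((ℓ : ℕ) : NumberField.RingOfIntegers K) ∈ v.asIdeal) (τ : v.adicCompletion K →+* PadicAlgCl ℓ), Continuous τ → ∀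 w : ℤ, (ρ.labelledHodgeTateWeightsAt v (Literature.NumberTheory.PAdicHodge.fontainePstAdicCompletion v ℓ hv).algebra (Literature.NumberTheory.PAdicHodge.fontainePstAdicCompletion v ℓ hv).𝔅 τ).count w ≤ 2) → ∃ π : Literature.NumberTheory.Automorphic.CuspidalAutomorphicRepData n K hcpt, π.1.IsLAlgebraic ∧ ∀ᶠ v : IsDedekindDomain.HeightOneSpectrum (NumberField.RingOfIntegers K) in Filter.cofinite, Summit.Langlands.SatakeFrobCompatibleAt ι π.1 ρ v

/-- DEG₁ `DegenerateWeightOneReciprocity` — DECLARED RESIDUAL (rank 4) · [S-implied · WEAKER · BARRIER-SEALED]: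
AVR VERBATIM + «¬ (multiplicity ≤ 2)»: some label carries a Hodge–Tate weight of multiplicity ≥ 3.  Under the door:
every weight-one ρ of rank ≥ 5, and the partially definite ranks 3–4 ((3,0), (3,1), (4,0) at some label).  Contains the
generic principally polarised abelian varieties of dimension g ≥ 3 over every K (the director's «bulk of AVR»).  SEALED:
for such an infinitesimal character NO real form of U(n) / GSp_{2g} carries a non-zero limit of discrete series
(Knapp–Zuckerman), so π_f has no coherent or étale realisation in any Shimura variety (Mirković; Goldring §4.4.1 —
`Literature.Barriers.Langlands.ShimuraVarietyRealizationBarrier`, `NonRegularWeightBarrier`), no potential automorphy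
(automorphy lifting needs regular weight), and no locally-algebraic trace in completed cohomology (Emerton). -/
def DegenerateWeightOneReciprocity : Prop :=
  ∀ (K : Type) [Field K] [NumberField K] (n : ℕ) (hcpt : Literature.NumberTheory.Automorphic.isCompact_glFiniteIntegralLevel n K), 0 < n → ∀ (ℓ : ℕ) [Fact ℓ.Prime] (ι : PadicAlgCl ℓ ≃+* ℂ) (ρ : Literature.NumberTheory.GaloisRepresentations.FramedGaloisRep K (PadicAlgCl ℓ) n), ρ.toGaloisRep.IsIrreducible → ((∀ᶠ v : IsDedekindDomain.HeightOneSpectrum (NumberField.RingOfIntegers K) in Filter.cofinite, ρ.IsUnramifiedAt v) ∧ ∀ (v : IsDedekindDomain.HeightOneSpectrum (NumberField.RingOfIntegers K)) (hv : ((ℓ : ℕ) : NumberField.RingOfIntegers K) ∈ v.asIdeal), (Literature.NumberTheory.PAdicHodge.fontainePstAdicCompletion v ℓ hv).IsDeRhamFramed (ρ.toLocal v)) → (∃ (d : ℕ) (X : Literature.AlgebraicGeometry.Motives.SchemeOver K), Literature.AlgebraicGeometry.Motives.IsSmoothProjective d X ∧ ∃ (j : ℤ) (W : Submodule (PadicAlgCl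 ℓ) (TensorProduct ℚ_[ℓ] (PadicAlgCl ℓ) (Literature.AlgebraicGeometry.Motives.ellAdicEtaleCohomologyRat ℓ 1 (Literature.AlgebraicGeometry.Motives.geometricFibre K X)))) (hW : ∀ (g : Field.absoluteGaloisGroup K) (w : TensorProduct ℚ_[ℓ] (PadicAlgCl ℓ) (Literature.AlgebraicGeometry.Motives.ellAdicEtaleCohomologyRat ℓ 1 (Literature.AlgebraicGeometry.Motives.geometricFibre K X))), w ∈ W → (algebraMap ℚ_[ℓ] (PadicAlgCl ℓ) ((Literature.AlgebraicGeometry.Motives.padicCyclotomicCharacter K ℓ g : ℚ_[ℓ]ˣ) : ℚ_[ℓ])) ^ j • (Literature.AlgebraicGeometry.Motives.geometricEllAdicEtaleCohomologyRepRat ℓ X 1 g).baseChange (PadicAlgCl ℓ) w ∈ W) (f : W →ₗ[PadicAlgCl ℓ] (Fin n → PadicAlgCl ℓ)), Function.Surjective f ∧ ∀ (g : Field.absoluteGaloisGroup K) (w : W), f ⟨(algebraMap ℚ_[ℓ] (PadicAlgCl ℓ) ((Literature.AlgebraicGeometry.Motives.padicCyclotomicCharacter K ℓ g : ℚ_[ℓ]ˣ)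 : ℚ_[ℓ])) ^ j • (Literature.AlgebraicGeometry.Motives.geometricEllAdicEtaleCohomologyRepRat ℓ X 1 g).baseChange (PadicAlgCl ℓ) (w : TensorProduct ℚ_[ℓ] (PadicAlgCl ℓ) (Literature.AlgebraicGeometry.Motives.ellAdicEtaleCohomologyRat ℓ 1 (Literature.AlgebraicGeometry.Motives.geometricFibre K X))), hW g w w.2⟩ = ((ρ g : GL (Fin n) (PadicAlgCl ℓ)) : Matrix (Fin n) (Fin n) (PadicAlgCl ℓ)).mulVec (f w)) → ¬ (∀ (v : IsDedekindDomain.HeightOneSpectrum (NumberField.RingOfIntegers K)) (hv : ((ℓ : ℕ) : NumberField.RingOfIntegers K) ∈ v.asIdeal) (τ : v.adicCompletion K →+* PadicAlgCl ℓ), Continuous τ → ∀ w : ℤ, (ρ.labelledHodgeTateWeightsAt v (Literature.NumberTheory.PAdicHodge.fontainePstAdicCompletion v ℓ hv).algebra (Literature.NumberTheory.PAdicHodge.fontainePstAdicCompletion v ℓ hv).𝔅 τ).count w ≤ 2) → ∃ π : Literature.NumberTheory.Automorphic.CuspidalAutomorphicRepData n K hcpt, π.1.IsLAlgebraic ∧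 ∀ᶠ v : IsDedekindDomain.HeightOneSpectrum (NumberField.RingOfIntegers K) in Filter.cofinite, Summit.Langlands.SatakeFrobCompatibleAt ι π.1 ρ v

/-! ### Node-only statements (never items): the rank-bounded readings and the weight-one Hodge–Tate shape door -/

/-- REG₁ read on rank ≤ 2 only (insert `n ≤ 2 →`). -/
def RegularWeightOneReciprocityRankLeTwo : Prop :=
  ∀ (K : Type) [Field K] [NumberField K] (n : ℕ) (hcpt : Literature.NumberTheory.Automorphic.isCompact_glFiniteIntegralLevel n K), 0 < n → n ≤ 2 → ∀ (ℓ : ℕ) [Fact ℓ.Prime] (ι : PadicAlgCl ℓ ≃+* ℂ) (ρ : Literature.NumberTheory.GaloisRepresentations.FramedGaloisRep K (PadicAlgCl ℓ) n), ρ.toGaloisRep.IsIrreducible → ((∀ᶠ v : IsDedekindDomain.HeightOneSpectrum (NumberField.RingOfIntegers K) in Filter.cofinite, ρ.IsUnramifiedAt v) ∧ ∀ (v : IsDedekindDomain.HeightOneSpectrum (NumberField.RingOfIntegers K)) (hv : ((ℓ : ℕ) : NumberField.RingOfIntegers K) ∈ v.asIdeal), (Literature.NumberTheory.PAdicHodge.fontainePstAdicCompletion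 v ℓ hv).IsDeRhamFramed (ρ.toLocal v)) → (∃ (d : ℕ) (X : Literature.AlgebraicGeometry.Motives.SchemeOver K), Literature.AlgebraicGeometry.Motives.IsSmoothProjective d X ∧ ∃ (j : ℤ) (W : Submodule (PadicAlgCl ℓ) (TensorProduct ℚ_[ℓ] (PadicAlgCl ℓ) (Literature.AlgebraicGeometry.Motives.ellAdicEtaleCohomologyRat ℓ 1 (Literature.AlgebraicGeometry.Motives.geometricFibre K X)))) (hW : ∀ (g : Field.absoluteGaloisGroup K) (w : TensorProduct ℚ_[ℓ] (PadicAlgCl ℓ) (Literature.AlgebraicGeometry.Motives.ellAdicEtaleCohomologyRat ℓ 1 (Literature.AlgebraicGeometry.Motives.geometricFibre K X))), w ∈ W → (algebraMap ℚ_[ℓ] (PadicAlgCl ℓ) ((Literature.AlgebraicGeometry.Motives.padicCyclotomicCharacter K ℓ g : ℚ_[ℓ]ˣ) : ℚ_[ℓ])) ^ j • (Literature.AlgebraicGeometry.Motives.geometricEllAdicEtaleCohomologyRepRat ℓ X 1 g).baseChange (PadicAlgCl ℓ) w ∈ W) (f : W →ₗ[PadicAlgCl ℓ] (Fin n → PadicAlgCl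 ℓ)), Function.Surjective f ∧ ∀ (g : Field.absoluteGaloisGroup K) (w : W), f ⟨(algebraMap ℚ_[ℓ] (PadicAlgCl ℓ) ((Literature.AlgebraicGeometry.Motives.padicCyclotomicCharacter K ℓ g : ℚ_[ℓ]ˣ) : ℚ_[ℓ])) ^ j • (Literature.AlgebraicGeometry.Motives.geometricEllAdicEtaleCohomologyRepRat ℓ X 1 g).baseChange (PadicAlgCl ℓ) (w : TensorProduct ℚ_[ℓ] (PadicAlgCl ℓ) (Literature.AlgebraicGeometry.Motives.ellAdicEtaleCohomologyRat ℓ 1 (Literature.AlgebraicGeometry.Motives.geometricFibre K X))), hW g w w.2⟩ = ((ρ g : GL (Fin n) (PadicAlgCl ℓ)) : Matrix (Fin n) (Fin n) (PadicAlgCl ℓ)).mulVec (f w)) → (∀ (v : IsDedekindDomain.HeightOneSpectrum (NumberField.RingOfIntegers K)) (hv : ((ℓ : ℕ) : NumberField.RingOfIntegers K) ∈ v.asIdeal) (τ : v.adicCompletion K →+* PadicAlgCl ℓ), Continuous τ → ∀ w : ℤ, (ρ.labelledHodgeTateWeightsAt v (Literature.NumberTheory.PAdicHodge.fontainePstAdicCompletion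 v ℓ hv).algebra (Literature.NumberTheory.PAdicHodge.fontainePstAdicCompletion v ℓ hv).𝔅 τ).count w ≤ 1) → ∃ π : Literature.NumberTheory.Automorphic.CuspidalAutomorphicRepData n K hcpt, π.1.IsLAlgebraic ∧ ∀ᶠ v : IsDedekindDomain.HeightOneSpectrum (NumberField.RingOfIntegers K) in Filter.cofinite, Summit.Langlands.SatakeFrobCompatibleAt ι π.1 ρ v

/-- WALL₁ read on rank ≤ 4 only (insert `n ≤ 4 →`). -/
def WallWeightOneReciprocityRankLeFour : Prop :=
  ∀ (K : Type) [Field K] [NumberField K] (n : ℕ) (hcpt : Literature.NumberTheory.Automorphic.isCompact_glFiniteIntegralLevel n K), 0 < n → n ≤ 4 → ∀ (ℓ : ℕ) [Fact ℓ.Prime] (ι : PadicAlgCl ℓ ≃+* ℂ) (ρ : Literature.NumberTheory.GaloisRepresentations.FramedGaloisRep K (PadicAlgCl ℓ) n), ρ.toGaloisRep.IsIrreducible → ((∀ᶠ v : IsDedekindDomain.HeightOneSpectrum (NumberField.RingOfIntegers K) in Filter.cofinite, ρ.IsUnramifiedAt v) ∧ ∀ (v : IsDedekindDomain.HeightOneSpectrum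 (NumberField.RingOfIntegers K)) (hv : ((ℓ : ℕ) : NumberField.RingOfIntegers K) ∈ v.asIdeal), (Literature.NumberTheory.PAdicHodge.fontainePstAdicCompletion v ℓ hv).IsDeRhamFramed (ρ.toLocal v)) → (∃ (d : ℕ) (X : Literature.AlgebraicGeometry.Motives.SchemeOver K), Literature.AlgebraicGeometry.Motives.IsSmoothProjective d X ∧ ∃ (j : ℤ) (W : Submodule (PadicAlgCl ℓ) (TensorProduct ℚ_[ℓ] (PadicAlgCl ℓ) (Literature.AlgebraicGeometry.Motives.ellAdicEtaleCohomologyRat ℓ 1 (Literature.AlgebraicGeometry.Motives.geometricFibre K X)))) (hW : ∀ (g : Field.absoluteGaloisGroup K) (w : TensorProduct ℚ_[ℓ] (PadicAlgCl ℓ) (Literature.AlgebraicGeometry.Motives.ellAdicEtaleCohomologyRat ℓ 1 (Literature.AlgebraicGeometry.Motives.geometricFibre K X))), w ∈ W → (algebraMap ℚ_[ℓ] (PadicAlgCl ℓ) ((Literature.AlgebraicGeometry.Motives.padicCyclotomicCharacter K ℓ g : ℚ_[ℓ]ˣ) : ℚ_[ℓ])) ^ j • (Literature.AlgebraicGeometry.Motives.geometricEllAdicEtaleCohomologyRepRat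 ℓ X 1 g).baseChange (PadicAlgCl ℓ) w ∈ W) (f : W →ₗ[PadicAlgCl ℓ] (Fin n → PadicAlgCl ℓ)), Function.Surjective f ∧ ∀ (g : Field.absoluteGaloisGroup K) (w : W), f ⟨(algebraMap ℚ_[ℓ] (PadicAlgCl ℓ) ((Literature.AlgebraicGeometry.Motives.padicCyclotomicCharacter K ℓ g : ℚ_[ℓ]ˣ) : ℚ_[ℓ])) ^ j • (Literature.AlgebraicGeometry.Motives.geometricEllAdicEtaleCohomologyRepRat ℓ X 1 g).baseChange (PadicAlgCl ℓ) (w : TensorProduct ℚ_[ℓ] (PadicAlgCl ℓ) (Literature.AlgebraicGeometry.Motives.ellAdicEtaleCohomologyRat ℓ 1 (Literature.AlgebraicGeometry.Motives.geometricFibre K X))), hW g w w.2⟩ = ((ρ g : GL (Fin n) (PadicAlgCl ℓ)) : Matrix (Fin n) (Fin n) (PadicAlgCl ℓ)).mulVec (f w)) → ¬ (∀ (v : IsDedekindDomain.HeightOneSpectrum (NumberField.RingOfIntegers K)) (hv : ((ℓ : ℕ) : NumberField.RingOfIntegers K) ∈ v.asIdeal) (τ : v.adicCompletion K →+* PadicAlgCl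 ℓ), Continuous τ → ∀ w : ℤ, (ρ.labelledHodgeTateWeightsAt v (Literature.NumberTheory.PAdicHodge.fontainePstAdicCompletion v ℓ hv).algebra (Literature.NumberTheory.PAdicHodge.fontainePstAdicCompletion v ℓ hv).𝔅 τ).count w ≤ 1) → (∀ (v : IsDedekindDomain.HeightOneSpectrum (NumberField.RingOfIntegers K)) (hv : ((ℓ : ℕ) : NumberField.RingOfIntegers K) ∈ v.asIdeal) (τ : v.adicCompletion K →+* PadicAlgCl ℓ), Continuous τ → ∀ w : ℤ, (ρ.labelledHodgeTateWeightsAt v (Literature.NumberTheory.PAdicHodge.fontainePstAdicCompletion v ℓ hv).algebra (Literature.NumberTheory.PAdicHodge.fontainePstAdicCompletion v ℓ hv).𝔅 τ).count w ≤ 2) → ∃ π : Literature.NumberTheory.Automorphic.CuspidalAutomorphicRepData n K hcpt, π.1.IsLAlgebraic ∧ ∀ᶠ v : IsDedekindDomain.HeightOneSpectrum (NumberField.RingOfIntegers K) in Filter.cofinite, Summit.Langlands.SatakeFrobCompatibleAt ι π.1 ρ v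

/-- HTS `WeightOneHodgeTateShape` — PRINT DOOR (node-only, never an item, never a binder of `closes_target`):
for ρ irreducible, pinned-geometric and realisable in degree-1 étale cohomology (AVR's hypotheses VERBATIM) there is a
label (v, τ) above ℓ at which the labelled Hodge–Tate multiset of ρ has exactly n elements and at most two distinct
values.  In nature: Fontaine 1982 (abelian varieties) / Faltings 1988 (C_HT for H¹_ét of smooth projective X):
H¹ has Hodge–Tate weights {0, 1}, so an ε^j-twisted subquotient has weights ⊂ {−j, 1 − j} (sign convention
immaterial: «≤ 2 distinct values» is convention-free); `card = n` = Hodge–Tate decomposition is a grading of the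
n-dimensional D_HT.  Used ONLY for the finiteness readings `regularWeightOne_iff_rankLeTwo` / `wallWeightOne_iff_rankLeFour`. -/
def WeightOneHodgeTateShape : Prop :=
  ∀ (K : Type) [Field K] [NumberField K] (n : ℕ) (hcpt : Literature.NumberTheory.Automorphic.isCompact_glFiniteIntegralLevel n K), 0 < n → ∀ (ℓ : ℕ) [Fact ℓ.Prime] (ι : PadicAlgCl ℓ ≃+* ℂ) (ρ : Literature.NumberTheory.GaloisRepresentations.FramedGaloisRep K (PadicAlgCl ℓ) n), ρ.toGaloisRep.IsIrreducible → ((∀ᶠ v : IsDedekindDomain.HeightOneSpectrum (NumberField.RingOfIntegers K) in Filter.cofinite, ρ.IsUnramifiedAt v) ∧ ∀ (v : IsDedekindDomain.HeightOneSpectrum (NumberField.RingOfIntegers K)) (hv : ((ℓ : ℕ) : NumberField.RingOfIntegers K) ∈ v.asIdeal), (Literature.NumberTheory.PAdicHodge.fontainePstAdicCompletion v ℓ hv).IsDeRhamFramed (ρ.toLocal v)) → (∃ (d : ℕ) (X : Literature.AlgebraicGeometry.Motives.SchemeOver K), Literature.AlgebraicGeometry.Motives.IsSmoothProjective d X ∧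 ∃ (j : ℤ) (W : Submodule (PadicAlgCl ℓ) (TensorProduct ℚ_[ℓ] (PadicAlgCl ℓ) (Literature.AlgebraicGeometry.Motives.ellAdicEtaleCohomologyRat ℓ 1 (Literature.AlgebraicGeometry.Motives.geometricFibre K X)))) (hW : ∀ (g : Field.absoluteGaloisGroup K) (w : TensorProduct ℚ_[ℓ] (PadicAlgCl ℓ) (Literature.AlgebraicGeometry.Motives.ellAdicEtaleCohomologyRat ℓ 1 (Literature.AlgebraicGeometry.Motives.geometricFibre K X))), w ∈ W → (algebraMap ℚ_[ℓ] (PadicAlgCl ℓ) ((Literature.AlgebraicGeometry.Motives.padicCyclotomicCharacter K ℓ g : ℚ_[ℓ]ˣ) : ℚ_[ℓ])) ^ j • (Literature.AlgebraicGeometry.Motives.geometricEllAdicEtaleCohomologyRepRat ℓ X 1 g).baseChange (PadicAlgCl ℓ) w ∈ W) (f : W →ₗ[PadicAlgCl ℓ] (Fin n → PadicAlgCl ℓ)), Function.Surjective f ∧ ∀ (g : Field.absoluteGaloisGroup K) (w : W), f ⟨(algebraMap ℚ_[ℓ] (PadicAlgCl ℓ) ((Literature.AlgebraicGeometry.Motives.padicCyclotomicCharacter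 K ℓ g : ℚ_[ℓ]ˣ) : ℚ_[ℓ])) ^ j • (Literature.AlgebraicGeometry.Motives.geometricEllAdicEtaleCohomologyRepRat ℓ X 1 g).baseChange (PadicAlgCl ℓ) (w : TensorProduct ℚ_[ℓ] (PadicAlgCl ℓ) (Literature.AlgebraicGeometry.Motives.ellAdicEtaleCohomologyRat ℓ 1 (Literature.AlgebraicGeometry.Motives.geometricFibre K X))), hW g w w.2⟩ = ((ρ g : GL (Fin n) (PadicAlgCl ℓ)) : Matrix (Fin n) (Fin n) (PadicAlgCl ℓ)).mulVec (f w)) → ∃ (v : IsDedekindDomain.HeightOneSpectrum (NumberField.RingOfIntegers K)) (hv : ((ℓ : ℕ) : NumberField.RingOfIntegers K) ∈ v.asIdeal) (τ : v.adicCompletion K →+* PadicAlgCl ℓ), Continuous τ ∧ (ρ.labelledHodgeTateWeightsAt v (Literature.NumberTheory.PAdicHodge.fontainePstAdicCompletion v ℓ hv).algebra (Literature.NumberTheory.PAdicHodge.fontainePstAdicCompletion v ℓ hv).𝔅 τ).card = n ∧ (ρ.labelledHodgeTateWeightsAt v (Literature.NumberTheory.PAdicHodge.fontainePstAdicCompletion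 v ℓ hv).algebra (Literature.NumberTheory.PAdicHodge.fontainePstAdicCompletion v ℓ hv).𝔅 τ).toFinset.card ≤ 2

/-! ### Kernel: exact three-cell partition of AVR and the deciding compositions -/

/-- THE DECIDING THEOREM of the node: REG₁ → WALL₁ → DEG₁ → AVR (pointwise excluded middle on the two guards;
all three binders consumed). -/
theorem closes_target (hR : RegularWeightOneReciprocity) (hW : WallWeightOneReciprocity)
    (hD : DegenerateWeightOneReciprocity) :
    Summit.Langlands.Langlands.Theses.MotivicDictionarySplit.AbelianMotivicReciprocity :=
  fun K _ _ n hcpt hn ℓ _ ι ρ hirr hgeom hmot => by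
    by_cases h1 : HasLabelledHTMultiplicityAtMost K ℓ n ρ 1
    · exact hR K n hcpt hn ℓ ι ρ hirr hgeom hmot h1
    · by_cases h2 : HasLabelledHTMultiplicityAtMost K ℓ n ρ 2
      · exact hW K n hcpt hn ℓ ι ρ hirr hgeom hmot h1 h2
      · exact hD K n hcpt hn ℓ ι ρ hirr hgeom hmot h2

/-- AVR ⟹ REG₁ (restriction). -/
theorem regular_of_target (h : Summit.Langlands.Langlands.Theses.MotivicDictionarySplit.AbelianMotivicReciprocity) :
    RegularWeightOneReciprocity :=
  fun K _ _ n hcpt hn ℓ _ ι ρ hirr hgeom hmot _ => h K n hcpt hn ℓ ι ρ hirr hgeom hmot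

/-- AVR ⟹ WALL₁ (restriction). -/
theorem wall_of_target (h : Summit.Langlands.Langlands.Theses.MotivicDictionarySplit.AbelianMotivicReciprocity) :
    WallWeightOneReciprocity :=
  fun K _ _ n hcpt hn ℓ _ ι ρ hirr hgeom hmot _ _ => h K n hcpt hn ℓ ι ρ hirr hgeom hmot

/-- AVR ⟹ DEG₁ (restriction). -/
theorem degenerate_of_target (h : Summit.Langlands.Langlands.Theses.MotivicDictionarySplit.AbelianMotivicReciprocity) :
    DegenerateWeightOneReciprocity :=
  fun K _ _ n hcpt hn ℓ _ ι ρ hirr hgeom hmot _ => h K n hcpt hn ℓ ι ρ hirr hgeom hmot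

/-- EXACTNESS: AVR ⟺ REG₁ ∧ WALL₁ ∧ DEG₁ — the node adds no content beyond AVR and loses none. -/
theorem abelianMotivicReciprocity_iff_cells :
    Summit.Langlands.Langlands.Theses.MotivicDictionarySplit.AbelianMotivicReciprocity ↔
      (RegularWeightOneReciprocity ∧ WallWeightOneReciprocity ∧ DegenerateWeightOneReciprocity) :=
  ⟨fun h => ⟨regular_of_target h, wall_of_target h, degenerate_of_target h⟩,
   fun h => closes_target h.1 h.2.1 h.2.2⟩

/-- THROUGH THE PARENT: + HMR (27426) + NMR (27427) ⟹ B_w = `PrimeSwitchSplit.WeakGeometricAutomorphy` (17414), by the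
landed `MotivicDictionarySplit.closes`. -/
theorem closes_parent (hR : RegularWeightOneReciprocity) (hW : WallWeightOneReciprocity)
    (hD : DegenerateWeightOneReciprocity)
    (hH : Summit.Langlands.Langlands.Theses.MotivicDictionarySplit.HigherMotivicReciprocity)
    (hN : Summit.Langlands.Langlands.Theses.MotivicDictionarySplit.NonMotivicReciprocity) :
    Summit.Langlands.Langlands.Theses.PrimeSwitchSplit.WeakGeometricAutomorphy :=
  Summit.Langlands.Langlands.Theses.MotivicDictionarySplit.closes (closes_target hR hW hD) hH hN

/-- ROOT: … and with N0's other five items (`PrimeSwitchSplit.closes`) the pieces decide `Langlands`. -/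
theorem closes_root (hR : RegularWeightOneReciprocity) (hW : WallWeightOneReciprocity)
    (hD : DegenerateWeightOneReciprocity)
    (hH : Summit.Langlands.Langlands.Theses.MotivicDictionarySplit.HigherMotivicReciprocity)
    (hN : Summit.Langlands.Langlands.Theses.MotivicDictionarySplit.NonMotivicReciprocity)
    (hW' : Summit.Langlands.Langlands.Theses.PrimeSwitchSplit.SatakeAvatarExistence)
    (hP : Summit.Langlands.Langlands.Theses.PrimeSwitchSplit.PadicMemberCompatibility)
    (hAw : Summit.Langlands.Langlands.Theses.PrimeSwitchSplit.CompatibilityAwayFromLR)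
    (hRd : Summit.Langlands.Langlands.Theses.PrimeSwitchSplit.CanonicalReciprocityData)
    (hU : Summit.Langlands.Langlands.Theses.PrimeSwitchSplit.AvatarConjugacy) : _root_.Langlands :=
  Summit.Langlands.Langlands.Theses.PrimeSwitchSplit.closes (closes_parent hR hW hD hH hN) hW' hP hAw hRd hU

/-- LINEAGE JUNCTION (lens-2 g32 + g33, landed p828926 / p830093): the three cells ALSO replace AVR inside the
dissolution of HMR's abelian-type cell — REG₁ → WALL₁ → DEG₁ → TW1 → ATT → XRR → XIR → HMR. -/
theorem closes_hmr_dissolved (hR : RegularWeightOneReciprocity) (hW : WallWeightOneReciprocity)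
    (hD : DegenerateWeightOneReciprocity)
    (hT : Summit.Langlands.Langlands.Theorems.AbelianTypeDissolution.WeightOneTensorTransport)
    (hDict : Summit.Langlands.Langlands.Theorems.AbelianTypeDissolution.AbelianTypeIsTensorGenerated)
    (hXR : Summit.Langlands.Langlands.Theorems.AbelianTypeSplit.ExoticRegularReciprocity)
    (hXI : Summit.Langlands.Langlands.Theorems.AbelianTypeSplit.ExoticIrregularReciprocity) :
    Summit.Langlands.Langlands.Theses.MotivicDictionarySplit.HigherMotivicReciprocity :=
  Summit.Langlands.Langlands.Theorems.AbelianTypeDissolution.closes_hmr (closes_target hR hW hD) hT hDict hXR hXI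

/-- … so along the lens-2 lineage B_w ⟸ REG₁ ∧ WALL₁ ∧ DEG₁ ∧ TW1 ∧ ATT ∧ XRR ∧ XIR ∧ NMR (AVR and HMR both discharged). -/
theorem closes_parent_dissolved (hR : RegularWeightOneReciprocity) (hW : WallWeightOneReciprocity)
    (hD : DegenerateWeightOneReciprocity)
    (hT : Summit.Langlands.Langlands.Theorems.AbelianTypeDissolution.WeightOneTensorTransport)
    (hDict : Summit.Langlands.Langlands.Theorems.AbelianTypeDissolution.AbelianTypeIsTensorGenerated)
    (hXR : Summit.Langlands.Langlands.Theorems.AbelianTypeSplit.ExoticRegularReciprocity)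
    (hXI : Summit.Langlands.Langlands.Theorems.AbelianTypeSplit.ExoticIrregularReciprocity)
    (hN : Summit.Langlands.Langlands.Theses.MotivicDictionarySplit.NonMotivicReciprocity) :
    Summit.Langlands.Langlands.Theses.PrimeSwitchSplit.WeakGeometricAutomorphy :=
  Summit.Langlands.Langlands.Theses.MotivicDictionarySplit.closes (closes_target hR hW hD)
    (closes_hmr_dissolved hR hW hD hT hDict hXR hXI) hN

/-! ### S-implied certificates (each cell is a restriction of B_w: never false short of ¬B_w) -/

/-- B_w ⟹ REG₁. -/
theorem regular_of_weakGeometricAutomorphy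
    (h : Summit.Langlands.Langlands.Theses.PrimeSwitchSplit.WeakGeometricAutomorphy) : RegularWeightOneReciprocity :=
  fun K _ _ n hcpt hn ℓ _ ι ρ hirr hgeom _ _ => h K n hcpt hn ℓ ι ρ hirr hgeom

/-- B_w ⟹ WALL₁. -/
theorem wall_of_weakGeometricAutomorphy
    (h : Summit.Langlands.Langlands.Theses.PrimeSwitchSplit.WeakGeometricAutomorphy) : WallWeightOneReciprocity :=
  fun K _ _ n hcpt hn ℓ _ ι ρ hirr hgeom _ _ _ => h K n hcpt hn ℓ ι ρ hirr hgeom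

/-- B_w ⟹ DEG₁. -/
theorem degenerate_of_weakGeometricAutomorphy
    (h : Summit.Langlands.Langlands.Theses.PrimeSwitchSplit.WeakGeometricAutomorphy) : DegenerateWeightOneReciprocity :=
  fun K _ _ n hcpt hn ℓ _ ι ρ hirr hgeom _ _ => h K n hcpt hn ℓ ι ρ hirr hgeom

/-! ### Weight one makes the dial a FINITE TYPE LIST (kernel, modulo the Hodge–Tate shape door) -/

/-- A multiset whose every value has multiplicity ≤ c has at most c · #(distinct values) elements. -/
theorem card_le_mul_toFinset_card_of_count_le (M : Multiset ℤ) (c : ℕ) (h : ∀ w : ℤ, M.count w ≤ c) :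
    M.card ≤ c * M.toFinset.card := by
  classical
  calc M.card = ∑ w ∈ M.toFinset, M.count w := (Multiset.toFinset_sum_count_eq M).symm
    _ ≤ ∑ w ∈ M.toFinset, c := Finset.sum_le_sum fun w _ => h w
    _ = c * M.toFinset.card := by rw [Finset.sum_const, smul_eq_mul, mul_comm]

/-- REGULAR weight one has rank ≤ 2 (mod the door). -/
theorem rank_le_two_of_regular (hS : WeightOneHodgeTateShape) (K : Type) [Field K] [NumberField K] (n : ℕ)
    (hcpt : Literature.NumberTheory.Automorphic.isCompact_glFiniteIntegralLevel n K) (hn : 0 < n)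
    (ℓ : ℕ) [Fact ℓ.Prime] (ι : PadicAlgCl ℓ ≃+* ℂ)
    (ρ : Literature.NumberTheory.GaloisRepresentations.FramedGaloisRep K (PadicAlgCl ℓ) n)
    (hirr : ρ.toGaloisRep.IsIrreducible) (hgeom : ((∀ᶠ v : IsDedekindDomain.HeightOneSpectrum (NumberField.RingOfIntegers K) in Filter.cofinite, ρ.IsUnramifiedAt v) ∧ ∀ (v : IsDedekindDomain.HeightOneSpectrum (NumberField.RingOfIntegers K)) (hv : ((ℓ : ℕ) : NumberField.RingOfIntegers K) ∈ v.asIdeal), (Literature.NumberTheory.PAdicHodge.fontainePstAdicCompletion v ℓ hv).IsDeRhamFramed (ρ.toLocal v))) (hmot : (∃ (d : ℕ) (X : Literature.AlgebraicGeometry.Motives.SchemeOver K), Literature.AlgebraicGeometry.Motives.IsSmoothProjective d X ∧ ∃ (j : ℤ) (W : Submodule (PadicAlgCl ℓ) (TensorProduct ℚ_[ℓ] (PadicAlgCl ℓ) (Literature.AlgebraicGeometry.Motives.ellAdicEtaleCohomologyRat ℓ 1 (Literature.AlgebraicGeometry.Motives.geometricFibre K X)))) (hW : ∀ (g : Field.absoluteGaloisGroup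 K) (w : TensorProduct ℚ_[ℓ] (PadicAlgCl ℓ) (Literature.AlgebraicGeometry.Motives.ellAdicEtaleCohomologyRat ℓ 1 (Literature.AlgebraicGeometry.Motives.geometricFibre K X))), w ∈ W → (algebraMap ℚ_[ℓ] (PadicAlgCl ℓ) ((Literature.AlgebraicGeometry.Motives.padicCyclotomicCharacter K ℓ g : ℚ_[ℓ]ˣ) : ℚ_[ℓ])) ^ j • (Literature.AlgebraicGeometry.Motives.geometricEllAdicEtaleCohomologyRepRat ℓ X 1 g).baseChange (PadicAlgCl ℓ) w ∈ W) (f : W →ₗ[PadicAlgCl ℓ] (Fin n → PadicAlgCl ℓ)), Function.Surjective f ∧ ∀ (g : Field.absoluteGaloisGroup K) (w : W), f ⟨(algebraMap ℚ_[ℓ] (PadicAlgCl ℓ) ((Literature.AlgebraicGeometry.Motives.padicCyclotomicCharacter K ℓ g : ℚ_[ℓ]ˣ) : ℚ_[ℓ])) ^ j • (Literature.AlgebraicGeometry.Motives.geometricEllAdicEtaleCohomologyRepRat ℓ X 1 g).baseChange (PadicAlgCl ℓ) (w : TensorProduct ℚ_[ℓ] (PadicAlgCl ℓ) (Literature.AlgebraicGeometry.Motives.ellAdicEtaleCohomologyRat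 ℓ 1 (Literature.AlgebraicGeometry.Motives.geometricFibre K X))), hW g w w.2⟩ = ((ρ g : GL (Fin n) (PadicAlgCl ℓ)) : Matrix (Fin n) (Fin n) (PadicAlgCl ℓ)).mulVec (f w)))
    (h1 : HasLabelledHTMultiplicityAtMost K ℓ n ρ 1) : n ≤ 2 := by
  obtain ⟨v, hv, τ, hτ, hcard, hfin⟩ := hS K n hcpt hn ℓ ι ρ hirr hgeom hmot
  have hle := card_le_mul_toFinset_card_of_count_le _ 1 (h1 v hv τ hτ)
  rw [hcard] at hle
  omega

/-- VISIBLE weight one has rank ≤ 4 (mod the door). -/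
theorem rank_le_four_of_visible (hS : WeightOneHodgeTateShape) (K : Type) [Field K] [NumberField K] (n : ℕ)
    (hcpt : Literature.NumberTheory.Automorphic.isCompact_glFiniteIntegralLevel n K) (hn : 0 < n)
    (ℓ : ℕ) [Fact ℓ.Prime] (ι : PadicAlgCl ℓ ≃+* ℂ)
    (ρ : Literature.NumberTheory.GaloisRepresentations.FramedGaloisRep K (PadicAlgCl ℓ) n)
    (hirr : ρ.toGaloisRep.IsIrreducible) (hgeom : ((∀ᶠ v : IsDedekindDomain.HeightOneSpectrum (NumberField.RingOfIntegers K) in Filter.cofinite, ρ.IsUnramifiedAt v) ∧ ∀ (v : IsDedekindDomain.HeightOneSpectrum (NumberField.RingOfIntegers K)) (hv : ((ℓ : ℕ) : NumberField.RingOfIntegers K) ∈ v.asIdeal), (Literature.NumberTheory.PAdicHodge.fontainePstAdicCompletion v ℓ hv).IsDeRhamFramed (ρ.toLocal v))) (hmot : (∃ (d : ℕ) (X : Literature.AlgebraicGeometry.Motives.SchemeOver K), Literature.AlgebraicGeometry.Motives.IsSmoothProjective d X ∧ ∃ (j : ℤ) (W : Submodule (PadicAlgCl ℓ) (TensorProduct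 ℚ_[ℓ] (PadicAlgCl ℓ) (Literature.AlgebraicGeometry.Motives.ellAdicEtaleCohomologyRat ℓ 1 (Literature.AlgebraicGeometry.Motives.geometricFibre K X)))) (hW : ∀ (g : Field.absoluteGaloisGroup K) (w : TensorProduct ℚ_[ℓ] (PadicAlgCl ℓ) (Literature.AlgebraicGeometry.Motives.ellAdicEtaleCohomologyRat ℓ 1 (Literature.AlgebraicGeometry.Motives.geometricFibre K X))), w ∈ W → (algebraMap ℚ_[ℓ] (PadicAlgCl ℓ) ((Literature.AlgebraicGeometry.Motives.padicCyclotomicCharacter K ℓ g : ℚ_[ℓ]ˣ) : ℚ_[ℓ])) ^ j • (Literature.AlgebraicGeometry.Motives.geometricEllAdicEtaleCohomologyRepRat ℓ X 1 g).baseChange (PadicAlgCl ℓ) w ∈ W) (f : W →ₗ[PadicAlgCl ℓ] (Fin n → PadicAlgCl ℓ)), Function.Surjective f ∧ ∀ (g : Field.absoluteGaloisGroup K) (w : W), f ⟨(algebraMap ℚ_[ℓ] (PadicAlgCl ℓ) ((Literature.AlgebraicGeometry.Motives.padicCyclotomicCharacter K ℓ g : ℚ_[ℓ]ˣ) : ℚ_[ℓ]))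 ^ j • (Literature.AlgebraicGeometry.Motives.geometricEllAdicEtaleCohomologyRepRat ℓ X 1 g).baseChange (PadicAlgCl ℓ) (w : TensorProduct ℚ_[ℓ] (PadicAlgCl ℓ) (Literature.AlgebraicGeometry.Motives.ellAdicEtaleCohomologyRat ℓ 1 (Literature.AlgebraicGeometry.Motives.geometricFibre K X))), hW g w w.2⟩ = ((ρ g : GL (Fin n) (PadicAlgCl ℓ)) : Matrix (Fin n) (Fin n) (PadicAlgCl ℓ)).mulVec (f w)))
    (h2 : HasLabelledHTMultiplicityAtMost K ℓ n ρ 2) : n ≤ 4 := by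
  obtain ⟨v, hv, τ, hτ, hcard, hfin⟩ := hS K n hcpt hn ℓ ι ρ hirr hgeom hmot
  have hle := card_le_mul_toFinset_card_of_count_le _ 2 (h2 v hv τ hτ)
  rw [hcard] at hle
  omega

/-- REG₁ ⟺ REG₁ on rank ≤ 2 (mod the door): the regular weight-one cell IS rank-≤-2 weight one. -/
theorem regularWeightOne_iff_rankLeTwo (hS : WeightOneHodgeTateShape) :
    RegularWeightOneReciprocity ↔ RegularWeightOneReciprocityRankLeTwo :=
  ⟨fun h K _ _ n hcpt hn _ ℓ _ ι ρ hirr hgeom hmot h1 => h K n hcpt hn ℓ ι ρ hirr hgeom hmot h1,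
   fun h K _ _ n hcpt hn ℓ _ ι ρ hirr hgeom hmot h1 =>
     h K n hcpt hn (rank_le_two_of_regular hS K n hcpt hn ℓ ι ρ hirr hgeom hmot h1) ℓ ι ρ hirr hgeom hmot h1⟩

/-- WALL₁ ⟺ WALL₁ on rank ≤ 4 (mod the door): the visible exotic weight-one cell IS rank-≤-4. -/
theorem wallWeightOne_iff_rankLeFour (hS : WeightOneHodgeTateShape) :
    WallWeightOneReciprocity ↔ WallWeightOneReciprocityRankLeFour :=
  ⟨fun h K _ _ n hcpt hn _ ℓ _ ι ρ hirr hgeom hmot h1 h2 => h K n hcpt hn ℓ ι ρ hirr hgeom hmot h1 h2,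
   fun h K _ _ n hcpt hn ℓ _ ι ρ hirr hgeom hmot h1 h2 =>
     h K n hcpt hn (rank_le_four_of_visible hS K n hcpt hn ℓ ι ρ hirr hgeom hmot h2) ℓ ι ρ hirr hgeom hmot h1 h2⟩

/-- DEG₁ absorbs every rank ≥ 5 (mod the door): on rank ≥ 5 the node's partition has ONE cell. -/
theorem not_visible_of_five_le (hS : WeightOneHodgeTateShape) (K : Type) [Field K] [NumberField K] (n : ℕ)
    (hcpt : Literature.NumberTheory.Automorphic.isCompact_glFiniteIntegralLevel n K) (hn : 0 < n)
    (ℓ : ℕ) [Fact ℓ.Prime] (ι : PadicAlgCl ℓ ≃+* ℂ)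
    (ρ : Literature.NumberTheory.GaloisRepresentations.FramedGaloisRep K (PadicAlgCl ℓ) n)
    (hirr : ρ.toGaloisRep.IsIrreducible) (hgeom : ((∀ᶠ v : IsDedekindDomain.HeightOneSpectrum (NumberField.RingOfIntegers K) in Filter.cofinite, ρ.IsUnramifiedAt v) ∧ ∀ (v : IsDedekindDomain.HeightOneSpectrum (NumberField.RingOfIntegers K)) (hv : ((ℓ : ℕ) : NumberField.RingOfIntegers K) ∈ v.asIdeal), (Literature.NumberTheory.PAdicHodge.fontainePstAdicCompletion v ℓ hv).IsDeRhamFramed (ρ.toLocal v))) (hmot : (∃ (d : ℕ) (X : Literature.AlgebraicGeometry.Motives.SchemeOver K), Literature.AlgebraicGeometry.Motives.IsSmoothProjective d X ∧ ∃ (j : ℤ) (W : Submodule (PadicAlgCl ℓ) (TensorProduct ℚ_[ℓ] (PadicAlgCl ℓ) (Literature.AlgebraicGeometry.Motives.ellAdicEtaleCohomologyRat ℓ 1 (Literature.AlgebraicGeometry.Motives.geometricFibre K X)))) (hW : ∀ (g : Field.absoluteGaloisGroup K) (w : TensorProduct ℚ_[ℓ] (PadicAlgCl ℓ) (Literature.AlgebraicGeometry.Motives.ellAdicEtaleCohomologyRat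 ℓ 1 (Literature.AlgebraicGeometry.Motives.geometricFibre K X))), w ∈ W → (algebraMap ℚ_[ℓ] (PadicAlgCl ℓ) ((Literature.AlgebraicGeometry.Motives.padicCyclotomicCharacter K ℓ g : ℚ_[ℓ]ˣ) : ℚ_[ℓ])) ^ j • (Literature.AlgebraicGeometry.Motives.geometricEllAdicEtaleCohomologyRepRat ℓ X 1 g).baseChange (PadicAlgCl ℓ) w ∈ W) (f : W →ₗ[PadicAlgCl ℓ] (Fin n → PadicAlgCl ℓ)), Function.Surjective f ∧ ∀ (g : Field.absoluteGaloisGroup K) (w : W), f ⟨(algebraMap ℚ_[ℓ] (PadicAlgCl ℓ) ((Literature.AlgebraicGeometry.Motives.padicCyclotomicCharacter K ℓ g : ℚ_[ℓ]ˣ) : ℚ_[ℓ])) ^ j • (Literature.AlgebraicGeometry.Motives.geometricEllAdicEtaleCohomologyRepRat ℓ X 1 g).baseChange (PadicAlgCl ℓ) (w : TensorProduct ℚ_[ℓ] (PadicAlgCl ℓ) (Literature.AlgebraicGeometry.Motives.ellAdicEtaleCohomologyRat ℓ 1 (Literature.AlgebraicGeometry.Motives.geometricFibre K X))), hW g w w.2⟩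 = ((ρ g : GL (Fin n) (PadicAlgCl ℓ)) : Matrix (Fin n) (Fin n) (PadicAlgCl ℓ)).mulVec (f w))) (h5 : 5 ≤ n) :
    ¬ HasLabelledHTMultiplicityAtMost K ℓ n ρ 2 :=
  fun h2 => by have := rank_le_four_of_visible hS K n hcpt hn ℓ ι ρ hirr hgeom hmot h2; omega

#print axioms closes_target
#print axioms abelianMotivicReciprocity_iff_cells
#print axioms closes_parent
#print axioms closes_root
#print axioms closes_hmr_dissolved
#print axioms closes_parent_dissolved
#print axioms regularWeightOne_iff_rankLeTwo
#print axioms wallWeightOne_iff_rankLeFour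

end Summit.Langlands.Langlands.Theorems.WeightOneVisibilitySplit
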